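/-
Origin: expansion seat `prover-pub-hodgecm-mc-sinst-1-g9-0`, handover #1241 2026-08-20T21:33Z md5 dd045c8e7214 (286 l.; NEW additive leaf, ns HodgeCM.Model.ThetaSpace / HodgeCM.Model / HodgeCM.Model.ThetaAdelicSide; imports #1240 + PKG #R109 Model/TowerCarrier; §1 `rightShift_mem_adelicThetaSpanSat_of_conj` (any pair datum: R_h maps sat(KΓ) into sat(KΓ') when h⁻¹KΓ'h ⊆ KΓ — theta-3 rightTranslateStrict at level ⊥), `finToG_inv_mul_mul_mem_satLevelRegimeOf`, `ThetaAdelicSide.adelicThetaRepFin_mem_sat_conj` (g•F saturated at sat((Γ.conj g).K)), `mem_adelicThetaSpanSat_of_le`, `isHolGerm_adelicThetaRepFin`; §2 `towerFamily_adelicThetaRepFin` (family (g•F) h = t_1^*(family F (h g))), `towerFamily_adelicThetaRepFin_eq_translate` (= binder-1 translate g), **`ofLevel_towerFamily_adelicThetaRepFin`** (ofLevel (Γ.conj g) (family (g•F)) = act g (ofLevel Γ (family F)) — G_f-EQUIVARIANCE in the tower); §3 `towerFamily_restrictLevel`, `towerFamily_eq_restrictLevel`, **`ofLevel_towerFamily_of_le`**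 (level independence); §4 `towerFamily_add`, `towerFamily_smul`; NAME LIST: HodgeCM.Model.ThetaAdelicSide.ofLevel_towerFamily_adelicThetaRepFin · HodgeCM.Model.ThetaAdelicSide.ofLevel_towerFamily_of_le · HodgeCM.Model.ThetaAdelicSide.towerFamily_add) (`HOME/mc/pub-hodgecm-mc-sinst-1-g9/stage64/HodgeCM/Model/AdelicThetaTowerAction.lean`, md5 dd045c8e7214, 286 lines);
landed by the second packager p2 gen 14 (p2-g14) in gate run 64 as `HodgeCM/Model/AdelicThetaTowerAction.lean` (verbatim).
-/
/-
Copyright (c) 2026 the pub-hodgecm formalisation cell (harness21).  New file, not vendored.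
Origin: session prover-pub-hodgecm-mc-sinst-1-g9-0 (unit pub-hodgecm-mc-sinst-1-g9, S-INSTANCE CONSTRUCTOR gen 9; the (J2)↔(J4) seam of the
(J-Liu-Θ) junction behind E's row 9 `hΘ`, second half: compatibility of the cohomological theta family with the `U(V)(𝔸_f)`-action,
with the change of level and with addition), 2026-08-20.
Intended final place: `HodgeCM/Model/AdelicThetaTowerAction.lean` (NEW additive model-layer leaf; imports sinst-1's
`HodgeCM.Model.AdelicThetaTowerClass` (#1240) and binder-1's `HodgeCM.Model.TowerCarrier` (#R109); nothing imports it; drop alone).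
-/
import Summits.HodgeConjecture.HodgeCM.Model.AdelicThetaTowerClass
import Summits.HodgeConjecture.HodgeCM.Model.TowerCarrier

set_option autoImplicit false

/-!
# The cohomological theta family commutes with the `U(V)(𝔸_f)`-action, the change of level, and sums

Continuing `Model/AdelicThetaTowerClass` (#1240): for a saturated adèlic theta form `F` with holomorphic germs,
* §1 (any pair datum) **`rightShift_mem_adelicThetaSpanSat_of_conj`** — right translation by `h` centralising `ιinf` maps the
  `KΓ`-saturated module into the `KΓ'`-saturated one whenever `h⁻¹ KΓ' h ⊆ KΓ` (theta-3's `rightTranslateStrict` at level `⊥`); at the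
  regime model: `finToG_inv_mul_mul_mem_satLevelRegimeOf` (theta-3's discharged `hK` at `k_f := g⁻¹`) and
  **`ThetaAdelicSide.adelicThetaRepFin_mem_sat_conj`**: `g • F` is saturated at `sat((Γ.conj g).K)`; `IsHolGerm` rides along
  (`isHolGerm_adelicThetaRepFin`);
* §2 **`towerFamily_adelicThetaRepFin`**: the family of `g • F` at level `Γ.conj g` is binder-1's `translate g` of the family of `F`
  (componentwise `t_1^*` across `(Γ.conj g).conj h = Γ.conj (h g)`; #1239 `compAt_adelicThetaRepFin` + #1240 `pull_trPull_apply`),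
  hence **`ofLevel_towerFamily_adelicThetaRepFin`**: `ofLevel (Γ.conj g) ⟨family (g • F), _⟩ = act g (ofLevel Γ ⟨family F, _⟩)` in
  the tower (`act_ofLevel`) — the `G_f`-EQUIVARIANCE of `F ↦ ofLevel Γ (family F)`;
* §3 **`towerFamily_restrictLevel`** / **`ofLevel_towerFamily_of_le`** — independence of the level: at `Γ' ≤ Γ` the family is
  `restrictLevel` of the family at `Γ`, so its image in the tower is the same (`ofLevel_restrictLevel`);
* §4 **`towerFamily_add`** / **`towerFamily_smul`** — additivity and homogeneity in `F` (uniqueness of the component classes).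
Together: `F ↦ ofLevel Γ ⟨towerFamily F, _⟩` is a `ℂ`-linear `U(V)(𝔸_f)`-equivariant map from the saturated hol-germ part of the slot's
adèlic theta module to binder-1's `Tower … V` — the `cls` of the (J4) block-membership clause (`EquivariantLift.lift` against #R112).
KERNEL only: 0 records, 0 `def … : Prop`, nothing cited; `#print axioms` ⊆ {propext, Classical.choice, Quot.sound}.
-/

noncomputable section

open MulAction NumberField
open Literature.NumberTheory.Automorphic Literature.NumberTheory.Weil1964
open Literature.NumberTheory.Automorphic.WeightForms (restrictHom thetaClasses IsLevelCorrected IsWeightMatched)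
open Literature.Geometry.ComplexHyperbolic.BallModel (U21 x₀)
open Literature.AlgebraicGeometry.HodgeTheory Literature.AlgebraicGeometry.ShimuraVarieties
open Literature.NumberTheory.Automorphic.PicardCM
open Literature.NumberTheory.Automorphic.LevelOrbit (conjLevel mem_conjLevel_iff)
open Literature.NumberTheory.Transcendental (Arapura2012_Cor_15_4_6)
open HodgeCM.Model.SupplyResidual HodgeCM.Model.ThetaSpace HodgeCM.Model.LevelTranslate HodgeCM.Model.TowerLevel
open HodgeCM.Model.TowerCarrier

namespace HodgeCM
namespace Model

/-! ## §1. Right translation moves the saturation subgroup by conjugation -/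

namespace ThetaSpace

section Generic

variable {K L : Type} [Field K] [NumberField K] [Field L] [NumberField L] [Algebra K L] [FiniteDimensional K L]
variable {J : Type} [Fintype J] {GU : Type} [Group GU] [TopologicalSpace GU] [IsTopologicalGroup GU]
  [LocallyCompactSpace GU]
variable {P : WeilPairData K L J GU} [CompactSpace (GU ⧸ P.ΓU)]
variable {G₁ K₁ W : Type} [Group G₁] [Group K₁] [AddCommGroup W] [Module ℂ W] [Module.IsReflexive ℂ W]
variable {ιinf : G₁ →* GU} {κ₁ : K₁ →* G₁} {τ₁ : Representation ℂ K₁ W}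
variable {𝓕 : Set C(NumberField.relNormOneIdeles K L ⧸ NumberField.relNormOneRat K L, ℂ)}

/-- **Right translation by `h` (centralising `ιinf`) maps the `KΓ`-saturated module into the `KΓ'`-saturated one whenever
`h⁻¹ KΓ' h ⊆ KΓ`** (theta-3's `rightTranslateStrict`, read at level `⊥`). -/
theorem rightShift_mem_adelicThetaSpanSat_of_conj {h : GU} (hh : ∀ x : G₁, Commute h (ιinf x))
    {KΓ KΓ' : Subgroup GU} (hK : ∀ a ∈ KΓ', h⁻¹ * a * h ∈ KΓ) {F : GU → W}
    (hF : F ∈ adelicThetaSpanSat P ιinf κ₁ τ₁ KΓ 𝓕) : rightShift h F ∈ adelicThetaSpanSat P ιinf κ₁ τ₁ KΓ' 𝓕 := by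
  refine Submodule.iSup_induction _ (motive := fun F => rightShift (W := W) h F ∈ adelicThetaSpanSat P ιinf κ₁ τ₁ KΓ' 𝓕)
    hF ?_ ?_ ?_
  · rintro ⟨S, hsat, hstr⟩ F ⟨θ, hθ, rfl⟩
    have hcorr : ∀ δ ∈ (⊥ : Subgroup G₁), ∃ x ∈ KΓ', ιinf δ * x ∈ P.ΓU ∧ ∀ y : G₁, Commute x (ιinf y) :=
      fun δ hδ => ⟨1, one_mem _, by rw [(Subgroup.mem_bot).1 hδ, map_one, mul_one]; exact P.ΓU.one_mem,
        fun y => Commute.one_left _⟩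
    obtain ⟨θ', hθ', hcoe⟩ := S.exists_mem_thetaForms_coe_eq_rightTranslate hh hsat hK hcorr 𝓕 hθ
    have e : rightShift h ((weightForms P.ΓU S.κ S.τ).subtype θ) = (θ'.1 : GU → W) := by
      rw [hcoe]; rfl
    rw [e]
    exact coe_mem_adelicThetaSpanSat _ (hsat.rightTranslateStrict hh hK hcorr) (hstr.rightTranslateStrict hh hsat hK hcorr) hθ'
  · rw [map_zero]; exact Submodule.zero_mem _
  · intro F F' hF hF'
    rw [map_add]; exact Submodule.add_mem _ hF hF'

end Generic

end ThetaSpace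

section Regime

variable {L : CMField} {ι₁ : L →+* ℂ} (V : HermSpace3 L ι₁)

/-- **theta-3's discharged `hK` at `k_f := g⁻¹`**: conjugating by `finToG V hV g` takes `sat((Γ.conj g).K) = sat(gKg⁻¹)` back into `sat(K)`. -/
theorem finToG_inv_mul_mul_mem_satLevelRegimeOf (hV : IsAnisotropic L V.Hm) {Γ : Level V} (hΓ : Γ.BelowConjThree)
    (g : V.adelicFin) {a : (V.latticeModel printFact_unitaryCompact_holds).G}
    (ha : a ∈ satLevelRegimeOf V hV (Γ.conj g hΓ).K) :
    (finToG V hV g)⁻¹ * a * finToG V hV g ∈ satLevelRegimeOf V hV Γ.K := by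
  have key := inv_mul_mul_mem_satLevelRegimeOf_of_le_conjLevel V hV g⁻¹ (Level.K_conj_le_conjLevel Γ g hΓ) ha
  rwa [← finToG_eq_finTranslate] at key

namespace ThetaAdelicSide

variable {V} {c : SeesawCtx L} (S : ThetaAdelicSide V c)
variable {K₁ W : Type} [Group K₁] [AddCommGroup W] [Module ℂ W] [Module.IsReflexive ℂ W] {κ₁ : K₁ →* U21}
  {τ₁ : Representation ℂ K₁ W}
  {𝓕 : Set C(NumberField.relNormOneIdeles (↥(maximalRealSubfield L)) L ⧸ NumberField.relNormOneRat (↥(maximalRealSubfield L)) L, ℂ)}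

/-- **`g • F` is saturated at `sat((Γ.conj g).K)`** when `F` is saturated at `sat(Γ.K)`. -/
theorem adelicThetaRepFin_mem_sat_conj (hV : IsAnisotropic L V.Hm) (k : Fin 4) {Γ : Level V} (hΓ : Γ.BelowConjThree)
    {F : adelicThetaSpan (S.P k) S.ιinf κ₁ τ₁ 𝓕}
    (hF : F.1 ∈ adelicThetaSpanSat (S.P k) S.ιinf κ₁ τ₁ (satLevelRegimeOf V hV Γ.K) 𝓕) (g : V.adelicFin) :
    (S.adelicThetaRepFin hV k κ₁ τ₁ 𝓕 g F).1 ∈ adelicThetaSpanSat (S.P k) S.ιinf κ₁ τ₁ (satLevelRegimeOf V hV (Γ.conj g hΓ).K) 𝓕 :=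
  rightShift_mem_adelicThetaSpanSat_of_conj (S.commute_finToG_ιinf hV g)
    (fun _ ha => finToG_inv_mul_mul_mem_satLevelRegimeOf V hV hΓ g ha) hF

/-- A form saturated at `sat(Γ.K)` is saturated at `sat(Γ'.K)` for every smaller level `Γ' ≤ Γ`. -/
theorem mem_adelicThetaSpanSat_of_le (hV : IsAnisotropic L V.Hm) (k : Fin 4) {Γ Γ' : Level V} (hle : Γ' ≤ Γ)
    {F : (V.latticeModel printFact_unitaryCompact_holds).G → W}
    (hF : F ∈ adelicThetaSpanSat (S.P k) S.ιinf κ₁ τ₁ (satLevelRegimeOf V hV Γ.K) 𝓕) :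
    F ∈ adelicThetaSpanSat (S.P k) S.ιinf κ₁ τ₁ (satLevelRegimeOf V hV Γ'.K) 𝓕 :=
  adelicThetaSpanSat_anti (P := S.P k) (KΓ := satLevelRegimeOf V hV Γ.K) (KΓ' := satLevelRegimeOf V hV Γ'.K)
    (satLevelRegimeOf_mono V hV (Level.le_def.mp hle)) hF

/-- Holomorphic germs ride along the action (`IsHolGerm.comp_mul_right`, `finToG` commutes with `S.ιinf`). -/
theorem isHolGerm_adelicThetaRepFin (hV : IsAnisotropic L V.Hm) (k : Fin 4)
    {𝓕₂ : Set C(NumberField.relNormOneIdeles (↥(maximalRealSubfield L)) L ⧸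
      NumberField.relNormOneRat (↥(maximalRealSubfield L)) L, ℂ)}
    {F : adelicThetaSpan (S.P k) S.ιinf (stabilizer U21 x₀).subtype
      (BallForms.isPullbackCocycle_cotangentCocycle.weightOf x₀) 𝓕₂}
    (hhol : IsHolGerm S.ιinf F.1) (g : V.adelicFin) :
    IsHolGerm S.ιinf (S.adelicThetaRepFin hV k _ _ 𝓕₂ g F).1 :=
  hhol.comp_mul_right (S.commute_finToG_ιinf hV g)

end ThetaAdelicSide

end Regime

/-! ## §2. The family of `g • F` is `translate g` of the family of `F`; equivariance in the tower -/

section Action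

variable (hHD : exists_isReal_hodgeModel) (hI : hodgePQ_independent_of_hodgeModel)
  (h₁ : BallQuotientUniformised) (h₃ : CMAbelianVarietyRealised) (hA : Arapura2012_Cor_15_4_6)
variable {L : CMField} {ι₁ : L →+* ℂ} {V : HermSpace3 L ι₁} {c : SeesawCtx L}

namespace ThetaAdelicSide

variable (S : ThetaAdelicSide V c)
variable {𝓕 : Set C(NumberField.relNormOneIdeles (↥(maximalRealSubfield L)) L ⧸
    NumberField.relNormOneRat (↥(maximalRealSubfield L)) L, ℂ)}

/-- **The family of `g • F` at level `Γ.conj g` is binder-1's `translate g` of the family of `F` at level `Γ`**, componentwise: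
`compClass (g • F) h = t_1^* (compClass F (h g))` across `(Γ.conj g).conj h = Γ.conj (h g)`. -/
theorem towerFamily_adelicThetaRepFin (hV : IsAnisotropic L V.Hm) {k : Fin 4} {Γ : Level V} (hΓ : Γ.BelowConjThree)
    {F : adelicThetaSpan (S.P k) S.ιinf (stabilizer U21 x₀).subtype
      (BallForms.isPullbackCocycle_cotangentCocycle.weightOf x₀) 𝓕}
    (hF : F.1 ∈ adelicThetaSpanSat (S.P k) S.ιinf (stabilizer U21 x₀).subtype
      (BallForms.isPullbackCocycle_cotangentCocycle.weightOf x₀) (satLevelRegimeOf V hV Γ.K) 𝓕)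
    (hhol : IsHolGerm S.ιinf F.1) (g h : V.adelicFin) :
    S.towerFamily hHD hI h₁ h₃ hV (hΓ.conj g) (S.adelicThetaRepFin_mem_sat_conj hV k hΓ hF g)
        (S.isHolGerm_adelicThetaRepFin hV k hhol g) h =
      trPull hHD hI (ballQuotientUniformisedDatum_of h₁) h₃ hA 1 ((Γ.conj g hΓ).conj h (hΓ.conj g)) (Γ.conj (h * g) hΓ)
        (transCond_conj_conj hΓ g h) 1 (S.towerFamily hHD hI h₁ h₃ hV hΓ hF hhol (h * g)) := by
  refine eq_of_pull_eq hHD hI h₁ h₃ hV (S.compClass hHD hI h₁ h₃ hV (hΓ.conj g) _ _ h)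
    ⟨_, trPull_mem_H10 hHD hI h₁ h₃ hA hV _ (S.compClass hHD hI h₁ h₃ hV hΓ hF hhol (h * g))⟩ (funext fun x => ?_)
  rw [pull_trPull_apply, S.pull_compClass, S.pull_compClass, ratBall_one, one_mul]
  exact congrFun (S.compAt_adelicThetaRepFin hV k F g h) x

/-- As members of `towerLevel`: the family of `g • F` is `translate g` of the family of `F`. -/
theorem towerFamily_adelicThetaRepFin_eq_translate (hι : S.ιinf = archInfOf V) (hV : IsAnisotropic L V.Hm) {k : Fin 4}
    {Γ : Level V} (hΓ : Γ.BelowConjThree)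
    {F : adelicThetaSpan (S.P k) S.ιinf (stabilizer U21 x₀).subtype
      (BallForms.isPullbackCocycle_cotangentCocycle.weightOf x₀) 𝓕}
    (hF : F.1 ∈ adelicThetaSpanSat (S.P k) S.ιinf (stabilizer U21 x₀).subtype
      (BallForms.isPullbackCocycle_cotangentCocycle.weightOf x₀) (satLevelRegimeOf V hV Γ.K) 𝓕)
    (hhol : IsHolGerm S.ιinf F.1) (g : V.adelicFin) :
    (⟨_, S.towerFamily_mem hHD hI h₁ h₃ hA hι hV (hΓ.conj g) (S.adelicThetaRepFin_mem_sat_conj hV k hΓ hF g)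
        (S.isHolGerm_adelicThetaRepFin hV k hhol g)⟩ :
        towerLevel hHD hI (ballQuotientUniformisedDatum_of h₁) h₃ hA (Γ.conj g hΓ) (hΓ.conj g)) =
      TowerLevel.translate hHD hI (ballQuotientUniformisedDatum_of h₁) h₃ hA hΓ g
        ⟨_, S.towerFamily_mem hHD hI h₁ h₃ hA hι hV hΓ hF hhol⟩ := by
  apply Subtype.ext
  funext h
  rw [TowerLevel.translate_apply]
  exact S.towerFamily_adelicThetaRepFin hHD hI h₁ h₃ hA hV hΓ hF hhol g h

/-- **`G_f`-EQUIVARIANCE IN THE TOWER**: `ofLevel (Γ.conj g) (family (g • F)) = act g (ofLevel Γ (family F))`. -/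
theorem ofLevel_towerFamily_adelicThetaRepFin (hι : S.ιinf = archInfOf V) (hV : IsAnisotropic L V.Hm) {k : Fin 4}
    {Γ : Level V} (hΓ : Γ.BelowConjThree)
    {F : adelicThetaSpan (S.P k) S.ιinf (stabilizer U21 x₀).subtype
      (BallForms.isPullbackCocycle_cotangentCocycle.weightOf x₀) 𝓕}
    (hF : F.1 ∈ adelicThetaSpanSat (S.P k) S.ιinf (stabilizer U21 x₀).subtype
      (BallForms.isPullbackCocycle_cotangentCocycle.weightOf x₀) (satLevelRegimeOf V hV Γ.K) 𝓕)
    (hhol : IsHolGerm S.ιinf F.1) (g : V.adelicFin) :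
    ofLevel hHD hI (ballQuotientUniformisedDatum_of h₁) h₃ hA (Γ.conj g hΓ) (hΓ.conj g)
        ⟨_, S.towerFamily_mem hHD hI h₁ h₃ hA hι hV (hΓ.conj g) (S.adelicThetaRepFin_mem_sat_conj hV k hΓ hF g)
          (S.isHolGerm_adelicThetaRepFin hV k hhol g)⟩ =
      act hHD hI (ballQuotientUniformisedDatum_of h₁) h₃ hA g
        (ofLevel hHD hI (ballQuotientUniformisedDatum_of h₁) h₃ hA Γ hΓ ⟨_, S.towerFamily_mem hHD hI h₁ h₃ hA hι hV hΓ hF hhol⟩) := by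
  rw [act_ofLevel, S.towerFamily_adelicThetaRepFin_eq_translate hHD hI h₁ h₃ hA hι hV hΓ hF hhol g]

/-! ## §3. Independence of the level -/

/-- **At a smaller level `Γ' ≤ Γ` the family is `restrictLevel` of the family at `Γ`** (componentwise `t_1^*` along the component
coverings; `F` saturated at `sat(Γ.K)` is saturated at `sat(Γ'.K)` by antitonicity). -/
theorem towerFamily_restrictLevel (hV : IsAnisotropic L V.Hm) {k : Fin 4} {Γ Γ' : Level V} (hle : Γ' ≤ Γ)
    (hΓ : Γ.BelowConjThree) (hΓ' : Γ'.BelowConjThree)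
    {F : (V.latticeModel printFact_unitaryCompact_holds).G → (Fin 2 → ℂ)}
    (hF : F ∈ adelicThetaSpanSat (S.P k) S.ιinf (stabilizer U21 x₀).subtype
      (BallForms.isPullbackCocycle_cotangentCocycle.weightOf x₀) (satLevelRegimeOf V hV Γ.K) 𝓕)
    (hhol : IsHolGerm S.ιinf F) (h : V.adelicFin) :
    S.towerFamily hHD hI h₁ h₃ hV hΓ' (S.mem_adelicThetaSpanSat_of_le hV k hle hF) hhol h =
      trPull hHD hI (ballQuotientUniformisedDatum_of h₁) h₃ hA 1 (Γ'.conj h hΓ') (Γ.conj h hΓ)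
        (transCond_conj_of_le hle hΓ hΓ' h) 1 (S.towerFamily hHD hI h₁ h₃ hV hΓ hF hhol h) := by
  refine eq_of_pull_eq hHD hI h₁ h₃ hV (S.compClass hHD hI h₁ h₃ hV hΓ' _ hhol h)
    ⟨_, trPull_mem_H10 hHD hI h₁ h₃ hA hV _ (S.compClass hHD hI h₁ h₃ hV hΓ hF hhol h)⟩ (funext fun x => ?_)
  rw [pull_trPull_apply, S.pull_compClass, S.pull_compClass, ratBall_one, one_mul]

/-- As members of `towerLevel`: the family at `Γ'` is `restrictLevel` of the family at `Γ`. -/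
theorem towerFamily_eq_restrictLevel (hι : S.ιinf = archInfOf V) (hV : IsAnisotropic L V.Hm) {k : Fin 4} {Γ Γ' : Level V}
    (hle : Γ' ≤ Γ) (hΓ : Γ.BelowConjThree) (hΓ' : Γ'.BelowConjThree)
    {F : (V.latticeModel printFact_unitaryCompact_holds).G → (Fin 2 → ℂ)}
    (hF : F ∈ adelicThetaSpanSat (S.P k) S.ιinf (stabilizer U21 x₀).subtype
      (BallForms.isPullbackCocycle_cotangentCocycle.weightOf x₀) (satLevelRegimeOf V hV Γ.K) 𝓕)
    (hhol : IsHolGerm S.ιinf F) :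
    (⟨_, S.towerFamily_mem hHD hI h₁ h₃ hA hι hV hΓ' (S.mem_adelicThetaSpanSat_of_le hV k hle hF) hhol⟩ :
        towerLevel hHD hI (ballQuotientUniformisedDatum_of h₁) h₃ hA Γ' hΓ') =
      restrictLevel hHD hI (ballQuotientUniformisedDatum_of h₁) h₃ hA hle hΓ hΓ'
        ⟨_, S.towerFamily_mem hHD hI h₁ h₃ hA hι hV hΓ hF hhol⟩ := by
  apply Subtype.ext
  funext h
  rw [TowerLevel.restrictLevel_apply]
  exact S.towerFamily_restrictLevel hHD hI h₁ h₃ hA hV hle hΓ hΓ' hF hhol h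

/-- **The image in the tower does not depend on the level** at which `F` is read. -/
theorem ofLevel_towerFamily_of_le (hι : S.ιinf = archInfOf V) (hV : IsAnisotropic L V.Hm) {k : Fin 4} {Γ Γ' : Level V}
    (hle : Γ' ≤ Γ) (hΓ : Γ.BelowConjThree) (hΓ' : Γ'.BelowConjThree)
    {F : (V.latticeModel printFact_unitaryCompact_holds).G → (Fin 2 → ℂ)}
    (hF : F ∈ adelicThetaSpanSat (S.P k) S.ιinf (stabilizer U21 x₀).subtype
      (BallForms.isPullbackCocycle_cotangentCocycle.weightOf x₀) (satLevelRegimeOf V hV Γ.K) 𝓕)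
    (hhol : IsHolGerm S.ιinf F) :
    ofLevel hHD hI (ballQuotientUniformisedDatum_of h₁) h₃ hA Γ' hΓ'
        ⟨_, S.towerFamily_mem hHD hI h₁ h₃ hA hι hV hΓ' (S.mem_adelicThetaSpanSat_of_le hV k hle hF) hhol⟩ =
      ofLevel hHD hI (ballQuotientUniformisedDatum_of h₁) h₃ hA Γ hΓ ⟨_, S.towerFamily_mem hHD hI h₁ h₃ hA hι hV hΓ hF hhol⟩ := by
  rw [S.towerFamily_eq_restrictLevel hHD hI h₁ h₃ hA hι hV hle hΓ hΓ' hF hhol, ofLevel_restrictLevel]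

/-! ## §4. Additivity and homogeneity in `F` -/

/-- The family is additive in `F` (uniqueness of the component classes; `pull` and `compAt` are additive). -/
theorem towerFamily_add (hV : IsAnisotropic L V.Hm) {k : Fin 4} {Γ : Level V} (hΓ : Γ.BelowConjThree)
    {F F' : (V.latticeModel printFact_unitaryCompact_holds).G → (Fin 2 → ℂ)}
    (hF : F ∈ adelicThetaSpanSat (S.P k) S.ιinf (stabilizer U21 x₀).subtype
      (BallForms.isPullbackCocycle_cotangentCocycle.weightOf x₀) (satLevelRegimeOf V hV Γ.K) 𝓕)
    (hF' : F' ∈ adelicThetaSpanSat (S.P k) S.ιinf (stabilizer U21 x₀).subtype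
      (BallForms.isPullbackCocycle_cotangentCocycle.weightOf x₀) (satLevelRegimeOf V hV Γ.K) 𝓕)
    (hhol : IsHolGerm S.ιinf F) (hhol' : IsHolGerm S.ιinf F') (h : V.adelicFin) :
    S.towerFamily hHD hI h₁ h₃ hV hΓ (Submodule.add_mem _ hF hF') (hhol.add hhol') h =
      S.towerFamily hHD hI h₁ h₃ hV hΓ hF hhol h + S.towerFamily hHD hI h₁ h₃ hV hΓ hF' hhol' h := by
  have e := eq_of_pull_eq hHD hI h₁ h₃ hV (S.compClass hHD hI h₁ h₃ hV hΓ (Submodule.add_mem _ hF hF') (hhol.add hhol') h)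
    (S.compClass hHD hI h₁ h₃ hV hΓ hF hhol h + S.compClass hHD hI h₁ h₃ hV hΓ hF' hhol' h) (by
      rw [map_add, Submodule.coe_add, S.pull_compClass, S.pull_compClass, S.pull_compClass]
      funext x; rfl)
  exact e

/-- The family is homogeneous in `F`. -/
theorem towerFamily_smul (hV : IsAnisotropic L V.Hm) {k : Fin 4} {Γ : Level V} (hΓ : Γ.BelowConjThree)
    {F : (V.latticeModel printFact_unitaryCompact_holds).G → (Fin 2 → ℂ)}
    (hF : F ∈ adelicThetaSpanSat (S.P k) S.ιinf (stabilizer U21 x₀).subtype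
      (BallForms.isPullbackCocycle_cotangentCocycle.weightOf x₀) (satLevelRegimeOf V hV Γ.K) 𝓕)
    (hhol : IsHolGerm S.ιinf F) (r : ℂ) (h : V.adelicFin) :
    S.towerFamily hHD hI h₁ h₃ hV hΓ (Submodule.smul_mem _ r hF) (hhol.smul r) h =
      r • S.towerFamily hHD hI h₁ h₃ hV hΓ hF hhol h := by
  have e := eq_of_pull_eq hHD hI h₁ h₃ hV (S.compClass hHD hI h₁ h₃ hV hΓ (Submodule.smul_mem _ r hF) (hhol.smul r) h)
    (r • S.compClass hHD hI h₁ h₃ hV hΓ hF hhol h) (by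
      rw [map_smul, Submodule.coe_smul, S.pull_compClass, S.pull_compClass]
      funext x; rfl)
  exact e

end ThetaAdelicSide

end Action

end Model
end HodgeCM

end
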